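import Summits.QuantumFields.BalabanUV.Beta.RemainderExplicitHistoryDiagonalMemoryZoneBackward

/-!
# RemainderExplicitHistoryDiagonalMemoryZoneEdge — ROAD P3, ORDER-0 PROFILE FAMILY: THE FUTURE FEEDBACK IS SUBCRITICAL (`Γ_j ≤ Wγ∕b`) AND THE
# LAST MEMORY POSITION IS MONOTONE FOR EVERY NON-INCREASING PROFILE — for two infrared-pinned runs of
# `β_{k+1} = b + Σ_{a≤k} ρ(a)·min(g_k, |g_k − g_{k−a}|)` with `ρ(1) ≥ ρ(2) ≥ ⋯`, memory `A`, `Σρ ≤ W`, `3Wγ ≤ 2b`: the sixth file's backward criterion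
# holds TRIVIALLY at `j = A − 1` (no extra sources ahead, future monotone by the first file's echo count, `Γ ≤ Wγ∕b ≤ 2∕3` by the asymptotic-freedom
# weights), so `d_{j+1} ≤ d_j` at EVERY `j ≥ A − 1` — one position more than the echo count; and the subcriticality hypothesis `Γ_j < 1` of the sixth
# file is automatic under `Wγ < b` (station S-d4p3-g54-1 «the echo count», seventh file)

Cell `pub-balaban`, β-function sub-cell, BINDER row D4 «RemainderConst leaves for Bałaban's split» (`HOME/BINDER-OWNERS.md`; owner lineage
`b2b-balaban-beta-an4`; this file by co-owner #3 lineage `b2b-balaban-beta-d4-p3`, road P3 «the reduction road», generation 54, station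
S-d4p3-g54-1, seventh file; imports the sixth file `RemainderExplicitHistoryDiagonalMemoryZoneBackward`), β-FLOW TEAM duty (1); FREEZE (0)
honoured (def-free module in road P3's own `RemainderExplicit*` series; no leaf, no interface, no Literature file).  SOURCE OF THE SHAPES ONLY:
[Balaban1987RG1] (0.20) p. 256, (0.31) and Thm 2 p. 259, §5 p. 298.  [folklore] real analysis about ONE explicit toy family (ours), road P3's
ORDER-0 PROFILE FAMILY (generation 44).
HONEST FRAMING: *"Discharging BetaPertH makes Bałaban's UV stability UNCONDITIONAL — a real constructive-QFT result; it is NOT the continuum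
limit and NOT the Clay problem."*  THIS FILE DISCHARGES NOTHING OF THE KIND; nothing of Bałaban's (1.22) is asserted or constructed; row D4
class UNCHANGED (critical-path width 0; instance 0∕1; D4 DISCHARGE NO DATE); NOT B12 Thm 2, NOT BetaPertH, NOT continuum, NOT Clay.  HONEST
DEPENDENCY: continuum YM on T⁴ ⇐ BetaPertH ∧ nine spine estimates (0/9 proved); BetaPertH ⇐ (D1) ∧ (D4) ∧ CAP+tail; G-an2-4 gates asym, D1
and NE2/3/4.  ABSOLUTE RULE: nothing is cited as a fact.  All letters NOT-IN-PRINT; `BetaFlowAsPrinted S` records a Markov β_n only.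

WHAT IS PROVED ([folklore]; 0 sorry; 0 `def`).  §1 **`futureFeedback_le`** (`Γ_j = Σ_{i∈[j,K−1)} ((g_i)³∕2)Σ_{a∈[1,K−i)} ρ(a) ≤ Wγ∕b` on every box run:
`…Weights.cube_le_weight` + `…Weights.sum_weights_lt_le`).  §2 **`disc_succ_le_disc_lastMemory`** (`d_A ≤ d_{A−1}` for every non-increasing profile
of memory `A ≥ 1`, `3Wγ ≤ 2b`), **`disc_succ_le_disc_from_lastMemory`** (`d_{j+1} ≤ d_j` for every `A − 1 ≤ j < K`).  With it the memory-zone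
positions still open for census (i′) are `1 ≤ j ≤ A − 2` (none for `A ≤ 2`; position 1 alone for three-step memory).
-/

noncomputable section

open Finset Filter Topology

namespace Summit.QuantumFields.BalabanUV.Beta.RemainderExplicitHistoryDiagonalMemoryZoneEdge

open Literature.MathematicalPhysics.QuantumFieldTheory.Balaban1983to89
open Literature.MathematicalPhysics.QuantumFieldTheory.Balaban1983to89.FlowStep
open Literature.MathematicalPhysics.QuantumFieldTheory.Balaban1983to89.T4CouplingMatching
open Literature.MathematicalPhysics.QuantumFieldTheory.Balaban1983to89.T4ContinuumCoupling
open Summit.QuantumFields.BalabanUV.Beta.RemainderExplicitHistoryDiagonalMonotone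
open Summit.QuantumFields.BalabanUV.Beta.RemainderExplicitHistoryDiagonalWeights
open Summit.QuantumFields.BalabanUV.Beta.RemainderExplicitHistoryDiagonalTwoRun
open Summit.QuantumFields.BalabanUV.Beta.RemainderExplicitHistoryDiagonalWindow
open Summit.QuantumFields.BalabanUV.Beta.RemainderExplicitHistoryDiagonalOneStepMonotone
open Summit.QuantumFields.BalabanUV.Beta.RemainderExplicitHistoryDiagonalEchoMonotone
open Summit.QuantumFields.BalabanUV.Beta.RemainderExplicitHistoryDiagonalMemoryZoneBackward

variable {β : HBeta} {b γ W : ℝ} {ρ : ℕ → ℝ}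

/-! ## §1 The feedback of the gaps ahead is subcritical: `Γ_j ≤ Wγ∕b` -/

/-- **THE FUTURE FEEDBACK IS AT MOST `Wγ∕b`.**  On a run of road P3's order-0 profile family in ]0,γ] (`b > 0`, `γ > 0`, `ρ ≥ 0`,
`Σ_{a<N} ρ(a) ≤ W`; `K` steps): for every `j`,
`Γ_j = Σ_{i∈[j,K−1)} ((g_i)³∕2)·Σ_{a∈[1,K−i)} ρ(a) ≤ Wγ∕b` — each partial mass is `≤ W`, each cube is at most its asymptotic-freedom weight
(`…Weights.cube_le_weight`) and the weights sum to `2γ∕b` uniformly in the cutoff (`…Weights.sum_weights_lt_le`).  Hence the subcriticality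
hypothesis `Γ_j < 1` of the sixth file's backward step is AUTOMATIC under the family's smallness `Wγ < b`. [cite: Balaban1987RG1, (0.31) p.259] -/
theorem futureFeedback_le
    (hβ : ∀ (k : ℕ) (p : Fin (k + 1) → ℝ),
      β k p = b + ∑ i : Fin (k + 1), ρ (k - i) * min (p (Fin.last k)) (|p (Fin.last k) - p i|))
    (hb : 0 < b) (hγ : 0 < γ) (hρ0 : ∀ a, 0 ≤ ρ a) (hρW : ∀ n, ∑ a ∈ range n, ρ a ≤ W) {K : ℕ} {g : ℕ → ℝ} (hA : RGEqH K β g)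
    (hbox : ∀ k, k ≤ K → 0 < g k ∧ g k ≤ γ) (j : ℕ) :
    ∑ i ∈ Ico j (K - 1), (g i) ^ 3 / 2 * ∑ a ∈ Ico 1 (K - i), ρ a ≤ W * γ / b := by
  have hlo : BetaLowerH b γ β :=
    RemainderExplicitHistoryHalfMomentWitness.lower (γ := γ) (lam := fun k i => ρ (k - i)) hβ (fun k i => hρ0 _)
  have hW : 0 ≤ W := by simpa using hρW 0
  -- each partial mass `Σ_{a∈[1,K−i)} ρ(a) ≤ Σ_{a<K−i} ρ(a) ≤ W`
  have hmass : ∀ i, ∑ a ∈ Ico 1 (K - i), ρ a ≤ W := by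
    intro i
    refine le_trans ?_ (hρW (K - i))
    exact Finset.sum_le_sum_of_subset_of_nonneg (fun a ha => by
      have := Finset.mem_Ico.mp ha; exact Finset.mem_range.mpr this.2) (fun a _ _ => hρ0 a)
  -- bound term by term by `(W∕2)·weight_i`, extend the range to `[0,K)`, and sum the weights
  have hterm : ∀ i ∈ Ico j (K - 1), (g i) ^ 3 / 2 * ∑ a ∈ Ico 1 (K - i), ρ a
      ≤ W / 2 * (1 / (sprof γ b (K - i)) ^ 2 * (1 / sprof γ b (K - i))) := by
    intro i hi
    have hi' := Finset.mem_Ico.mp hi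
    have hiK : i ≤ K := by omega
    have hcube := cube_le_weight hγ hb hA hbox hlo hiK
    have hg3 : 0 ≤ (g i) ^ 3 := pow_nonneg (hbox i hiK).1.le 3
    have hw0 : 0 ≤ 1 / (sprof γ b (K - i)) ^ 2 * (1 / sprof γ b (K - i)) := by
      have := sprof_pos hγ hb.le (K - i); positivity
    calc (g i) ^ 3 / 2 * ∑ a ∈ Ico 1 (K - i), ρ a ≤ (g i) ^ 3 / 2 * W :=
          mul_le_mul_of_nonneg_left (hmass i) (by positivity)
      _ = W / 2 * (g i) ^ 3 := by ring
      _ ≤ W / 2 * (1 / (sprof γ b (K - i)) ^ 2 * (1 / sprof γ b (K - i))) := mul_le_mul_of_nonneg_left hcube (by positivity)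
  have hsub : Ico j (K - 1) ⊆ range K := fun i hi => by
    have := Finset.mem_Ico.mp hi; exact Finset.mem_range.mpr (by omega)
  calc ∑ i ∈ Ico j (K - 1), (g i) ^ 3 / 2 * ∑ a ∈ Ico 1 (K - i), ρ a
      ≤ ∑ i ∈ Ico j (K - 1), W / 2 * (1 / (sprof γ b (K - i)) ^ 2 * (1 / sprof γ b (K - i))) := Finset.sum_le_sum hterm
    _ ≤ ∑ i ∈ range K, W / 2 * (1 / (sprof γ b (K - i)) ^ 2 * (1 / sprof γ b (K - i))) := by
        refine Finset.sum_le_sum_of_subset_of_nonneg hsub fun i _ _ => ?_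
        have := sprof_pos hγ hb.le (K - i); positivity
    _ = W / 2 * ∑ i ∈ range K, 1 / (sprof γ b (K - i)) ^ 2 * (1 / sprof γ b (K - i)) := by rw [Finset.mul_sum]
    _ ≤ W / 2 * (2 * γ / b) := mul_le_mul_of_nonneg_left (sum_weights_lt_le hγ hb K) (by positivity)
    _ = W * γ / b := by ring

/-! ## §2 The last memory position: monotone under `3Wγ ≤ 2b`, every non-increasing profile -/

/-- **THE LAST MEMORY POSITION IS MONOTONE.**  Road P3's order-0 profile family in ]0,γ] (`b > 0`, `γ > 0`) with a profile non-increasing on the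
positive ages and memory `A ≥ 1` (`ρ(a) = 0` for `a > A`), `Σ_{a<N} ρ(a) ≤ W`, `3Wγ ≤ 2b`; two pinned runs A: `K` ∕ B: `K + n` with `A − 1 < K`.
THEN `d_A ≤ d_{A−1}` — the sixth file's backward step at `j = A − 1`: the future (the stretch) is monotone by the first file's echo count, there are
NO extra sources ahead (`U_A = 0`: every age beyond `A` carries no weight), the future feedback is `Γ ≤ Wγ∕b ≤ 2∕3 < 1` (`futureFeedback_le`) and
`1 − Γ − Wγ∕(2b) ≥ 0`, so the backward criterion holds trivially. [cite: Balaban1987RG1, (0.20) p.256, (0.31) and Thm 2 p.259] -/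
theorem disc_succ_le_disc_lastMemory
    (hβ : ∀ (k : ℕ) (p : Fin (k + 1) → ℝ),
      β k p = b + ∑ i : Fin (k + 1), ρ (k - i) * min (p (Fin.last k)) (|p (Fin.last k) - p i|))
    (hb : 0 < b) (hγ : 0 < γ) (hρ0 : ∀ a, 0 ≤ ρ a) (hρW : ∀ n, ∑ a ∈ range n, ρ a ≤ W) (hmono : ∀ a, 1 ≤ a → ρ (a + 1) ≤ ρ a)
    (hWγ : 3 * (W * γ) ≤ 2 * b) {A : ℕ} (hA1 : 1 ≤ A) (hρA : ∀ a, A < a → ρ a = 0) {K n : ℕ} {gA gB : ℕ → ℝ} (hA : RGEqH K β gA)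
    (hB : RGEqH (K + n) β gB) (hAbox : ∀ k, k ≤ K → 0 < gA k ∧ gA k ≤ γ) (hBpos : ∀ k, k ≤ K + n → 0 < gB k)
    (hpin : gA K = gB (K + n)) (hAK : A - 1 < K) :
    1 / (gB (A - 1 + 1 + n)) ^ 2 - 1 / (gA (A - 1 + 1)) ^ 2 ≤ 1 / (gB (A - 1 + n)) ^ 2 - 1 / (gA (A - 1)) ^ 2 := by
  have hApos : ∀ k, k ≤ K → 0 < gA k := fun k hk => (hAbox k hk).1
  have hdom := invSq_le_invSq_shift_run hβ hb hρ0 hA hB hApos hBpos hpin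
  have hWγ2 : W * γ ≤ 2 * b := by linarith
  have hW : 0 ≤ W := by simpa using hρW 0
  -- the future (the stretch) is monotone by the echo count
  have hfut : ∀ l, A - 1 < l → l < K → 1 / (gB (l + 1 + n)) ^ 2 - 1 / (gA (l + 1)) ^ 2 ≤ 1 / (gB (l + n)) ^ 2 - 1 / (gA l) ^ 2 :=
    fun l hl hlK => disc_succ_le_disc_of_memory_le hβ hb hρ0 hρW hmono hWγ2 hρA hA hB hAbox hBpos hpin (by omega) hlK
  -- subcritical future feedback
  have hΓle := futureFeedback_le hβ hb hγ hρ0 hρW hA hAbox (A - 1)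
  have hw : W * γ / b ≤ 2 / 3 := by
    rw [div_le_iff₀ hb]; linarith
  have hΓ : ∑ i ∈ Ico (A - 1) (K - 1), (gA i) ^ 3 / 2 * ∑ a ∈ Ico 1 (K - i), ρ a < 1 := by linarith
  -- no extra sources ahead of the last memory position
  have hU : ∑ l ∈ Ico (A - 1 + 1) K, ∑ i ∈ range n, ρ (l + n - i) * (gB (l + n) - gB i) = 0 := by
    refine Finset.sum_eq_zero fun l hl => Finset.sum_eq_zero fun i hi => ?_
    have hl' := (Finset.mem_Ico.mp hl).1
    have hi' := Finset.mem_range.mp hi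
    rw [hρA (l + n - i) (by omega), zero_mul]
  refine disc_succ_le_disc_of_backward_criterion hβ hb hρ0 hρW hmono hA hB hAbox hBpos hpin hAK hfut hΓ ?_
  rw [hU, mul_zero]
  have hE : 0 ≤ ∑ i ∈ range n, ρ (A - 1 + n - i) * (gB (A - 1 + n) - gB i) :=
    extra_nonneg hβ hb hρ0 hB hBpos (j := A - 1) hAK.le
  have hS : 0 ≤ ∑ i ∈ range (A - 1), ρ (A - 1 - i) * (gA i - gB (i + n)) :=
    Finset.sum_nonneg fun i hi => mul_nonneg (hρ0 _) (by
      have hi' := Finset.mem_range.mp hi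
      linarith [le_of_one_div_sq_le (hApos i (by omega)) (hBpos (i + n) (by omega)) (hdom i (by omega))])
  have hc1 : 0 ≤ 1 - ∑ i ∈ Ico (A - 1) (K - 1), (gA i) ^ 3 / 2 * ∑ a ∈ Ico 1 (K - i), ρ a := by linarith
  have hc2 : 0 ≤ 1 - (∑ i ∈ Ico (A - 1) (K - 1), (gA i) ^ 3 / 2 * ∑ a ∈ Ico 1 (K - i), ρ a) - W * γ / (2 * b) := by
    have : W * γ / (2 * b) = (W * γ / b) / 2 := by field_simp
    rw [this]; linarith
  exact add_nonneg (mul_nonneg hc1 hE) (mul_nonneg hc2 hS)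

/-- **MONOTONE FROM THE LAST MEMORY POSITION ON.**  Same setting: `d_{j+1} ≤ d_j` for every `j` with `A − 1 ≤ j < K` — one position more than the
first file's echo count (which starts at `j = A`), for EVERY non-increasing profile of memory `A`, at the price `3Wγ ≤ 2b`.  For two-step memory this
re-proves the second file's position `1` (there under `Wγ ≤ b`); for three-step memory it leaves position `1` alone open.
[cite: Balaban1987RG1, (0.20) p.256, (0.31) and Thm 2 p.259] -/
theorem disc_succ_le_disc_from_lastMemory
    (hβ : ∀ (k : ℕ) (p : Fin (k + 1) → ℝ),
      β k p = b + ∑ i : Fin (k + 1), ρ (k - i) * min (p (Fin.last k)) (|p (Fin.last k) - p i|))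
    (hb : 0 < b) (hγ : 0 < γ) (hρ0 : ∀ a, 0 ≤ ρ a) (hρW : ∀ n, ∑ a ∈ range n, ρ a ≤ W) (hmono : ∀ a, 1 ≤ a → ρ (a + 1) ≤ ρ a)
    (hWγ : 3 * (W * γ) ≤ 2 * b) {A : ℕ} (hA1 : 1 ≤ A) (hρA : ∀ a, A < a → ρ a = 0) {K n : ℕ} {gA gB : ℕ → ℝ} (hA : RGEqH K β gA)
    (hB : RGEqH (K + n) β gB) (hAbox : ∀ k, k ≤ K → 0 < gA k ∧ gA k ≤ γ) (hBpos : ∀ k, k ≤ K + n → 0 < gB k)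
    (hpin : gA K = gB (K + n)) {j : ℕ} (hAj : A - 1 ≤ j) (hj : j < K) :
    1 / (gB (j + 1 + n)) ^ 2 - 1 / (gA (j + 1)) ^ 2 ≤ 1 / (gB (j + n)) ^ 2 - 1 / (gA j) ^ 2 := by
  rcases Nat.lt_or_ge j A with hjA | hjA
  · have hjeq : j = A - 1 := by omega
    subst hjeq
    exact disc_succ_le_disc_lastMemory hβ hb hγ hρ0 hρW hmono hWγ hA1 hρA hA hB hAbox hBpos hpin hj
  · exact disc_succ_le_disc_of_memory_le hβ hb hρ0 hρW hmono (by linarith) hρA hA hB hAbox hBpos hpin hjA hj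

end Summit.QuantumFields.BalabanUV.Beta.RemainderExplicitHistoryDiagonalMemoryZoneEdge
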